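import Summits.BirchSwinnertonDyer.BirchSwinnertonDyer.Theorems.AdditiveBranchIMCTwistRootNumberTwistedField
import Summits.BirchSwinnertonDyer.BirchSwinnertonDyer.Theorems.AdditiveBranchIMCTwistRootNumberTwistedClass
import Summits.BirchSwinnertonDyer.BirchSwinnertonDyer.Theorems.AdditiveBranchIMCGordTwoRankOneWanAnyRoadDefs
import Summits.BirchSwinnertonDyer.Rank1Residual.Additive.N10LowerHalfStatements
import Literature.NumberTheory.EllipticCurves.Rank1Residual.Typed.JointLower
import HarnessLib

/-!
# Route `AdditiveBranchIMC`, cruxes `GordTwoRankZeroOffCaseOne` (19357) / `GordTwoRankOne` (19358): the VOCABULARY of brick E3′ — «a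
# potentially-multiplicative additive twist-type prime `ℓ₀` as the `K`-RAMIFIED Wan prime» — under the Theorems import fence (definitions;
# nothing asserted) and the first-cut engine BY NAME

The predicates of the pen's checked sketch `Cruxes/GordTwoRankOne/TwistedWanSketch.lean` v4 (e19 memo v6 583e9725031fffc1), BYTE-IDENTICAL in
body, and the two r0 sub-row predicates of the registered 19357 skeleton `Lines/three_field_road.lean` v37 (sha 59b06a67705d22fc, LEAD g15), so that
(i) Theorems-side kernel lemmas and the future port of the [L] stubs `stub_twistedWanChainR0` (19357) / `stub_twistedWanChain` (19358) can be
stated over NAMED predicates, and (ii) registered stubs can be closed BY NAME AND SIGNATURE from Theorems files (δ-unfolding), exactly as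
`AdditiveBranchIMCGordTwoRankOneWanAnyRoadDefs.lean` (p777547) did for brick E2. Cruxes files are not importable by Theorems (D-0016), hence
this copy.

* `primeStar ℓ = (−1)^{⌊ℓ/2⌋} ℓ`;
* `TwistedWanPrime W p ℓ` — `ℓ ≠ p` odd, `E` additive at `ℓ`, `W₁ = E^{(ℓ*)}` multiplicative at `ℓ`, `p ∤ v_ℓ(j)`;
* `NonsplitClassAt W ℓ K` — `ℓ ∣ d_K` and `(d_K/ℓ* / ℓ) = −1` or `+1` according as `W₁` is split or not at `ℓ`;
* `TameRoadFieldTwisted W p ℓ K` — the E3′ road field;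
* `TwistedWanRoadRow`, `TwistedWanRoadRowFirstCutA` (rank-one line 19358, sketch v4) and `TwistedWanRowR0`, `TwistedWanRowR0FirstCutA` (rank-zero
  line 19357 v37: the same with the Tamagawa clause `p ∤ ∏ c_ℓ`);
* `FieldOneTwisted`, `FieldOneTwistedR0` — the field-one supply statements (their proofs need Friedberg–Hoffstein 1995 Thm B in the general form,
  reading R5, NOT in the tree);
* `EngineTwistedFirstCut` — the statement «`w(E^{(d_K)}) = −w(E)` for a twisted road field, case A, `E` not additive at `2`», with its PROOF
  `engineTwistedFirstCut_holds` (`TwistRootNumberTwisted.rootNumber_quadraticTwist_discr_eq_neg_of_twistedRoadField_caseA`, p796997).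

HONEST FRAMING: definitions and one proved statement; no named fact is minted, nothing is booked; 19357 / 19358 stay OPEN; BSD is proved for no
curve. A prover does not file statement items (D-0014). Seat prover-cruxlead-stmt-BirchSwinnertonDyer-19357-g15-0 (LEAD, director-bsd (661)(A)(b)).
References: [SkinnerUrban2014] Thm. 3.6.4; [FriedbergHoffstein1995] Thm. B; [Hsieh2014] Thm. B, Hypothesis A; [CaiShuTian2014] Thm 1.1;
[Rohrlich1993Compositio] Prop. 2–3; [AtkinLi1978] §1, §3.
-/

set_option autoImplicit false
set_option linter.dupNamespace false

noncomputable section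

open scoped Classical

open NumberField IsDedekindDomain IsDedekindDomain.HeightOneSpectrum Rat.HeightOneSpectrum
open WeierstrassCurve Literature.NumberTheory.EllipticCurves
  Literature.NumberTheory.EllipticCurves.ModularForms
  Literature.NumberTheory.EllipticCurves.Rank1Residual
open Summit.BirchSwinnertonDyer.Rank1Residual
open Summit.BirchSwinnertonDyer.Rank1Residual.Additive
open Summit.BirchSwinnertonDyer.BirchSwinnertonDyer.Theorems

namespace Summit.BirchSwinnertonDyer.BirchSwinnertonDyer.Theorems.TwistedWanRoad

/-- `ℓ* = (−1)^{⌊ℓ/2⌋} ℓ` (the kernel's spelling of `(−1)^{(ℓ−1)/2} ℓ` for an odd prime `ℓ`; sketch v4 verbatim). [notation-free helper] -/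
def primeStar (ℓ : ℕ) : ℤ := (-1) ^ (ℓ / 2) * ℓ

/-- Unfolding lemma for `primeStar`. [folklore] -/
theorem primeStar_eq (ℓ : ℕ) : primeStar ℓ = (-1) ^ (ℓ / 2) * ℓ := rfl

/-- THE E3′ WAN PRIME (sketch v4 verbatim): an ODD prime `ℓ ≠ p` at which `E` (globally minimal `W`) is ADDITIVE, of quadratic-twist type AND
POTENTIALLY MULTIPLICATIVE — `W₁ := E^{(ℓ*)}` has multiplicative reduction at `ℓ` —, with Skinner–Urban's ramification clause `p ∤ v_ℓ(j)`.
[predicate; nothing asserted] [cite: SkinnerUrban2014, Thm. 3.6.4] -/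
def TwistedWanPrime (W : WeierstrassCurve ℚ) [W.IsElliptic] (p ℓ : ℕ) [hℓ : Fact ℓ.Prime] : Prop :=
  ℓ ≠ p ∧ ℓ ≠ 2 ∧ W.HasAdditiveReductionAt ((primesEquiv (R := ℤ)).symm ⟨ℓ, hℓ.out⟩) ∧
    (W.quadraticTwist ((primeStar ℓ : ℤ) : ℚ)).HasMultiplicativeReductionAtPrime ℓ ∧
    ¬ (p : ℤ) ∣ padicValRat ℓ W.j

/-- THE CLASS CLAUSE at the E3′ Wan prime (sketch v4 verbatim): `ℓ ∣ d_K` and, writing `d_K = ℓ*·m`, `(m/ℓ) = +1` when `W₁ = E^{(ℓ*)}` is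
NON-split multiplicative at `ℓ` and `(m/ℓ) = −1` when it is split — the class for which `E/K_λ` (equivalently `E^{(d_K)}` over `ℚ_ℓ`) is
NON-split multiplicative (`TwistRootNumberTwisted.quadraticTwist_discr_nonsplit_at_of_caseA` for case A). [predicate; nothing asserted] -/
def NonsplitClassAt (W : WeierstrassCurve ℚ) [W.IsElliptic] (ℓ : ℕ) [Fact ℓ.Prime]
    (K : Type) [Field K] [NumberField K] : Prop :=
  (ℓ : ℤ) ∣ NumberField.discr K ∧
    legendreSym ℓ (NumberField.discr K / primeStar ℓ) =
      (if (W.quadraticTwist ((primeStar ℓ : ℤ) : ℚ)).HasSplitMultiplicativeReductionAtPrime ℓ then -1 else 1)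

/-- THE E3′ ROAD FIELD (sketch v4 verbatim): `K` imaginary quadratic with `d_K < −4`, the E3′ Wan prime `ℓ` RAMIFIED in `K` IN THE NON-SPLIT
CLASS, every other prime of `N_E` split, `2` split if `2 ∤ N_E`, `p` split or ramified. [predicate; nothing asserted] -/
def TameRoadFieldTwisted (W : WeierstrassCurve ℚ) [W.IsElliptic] [W.IsGloballyMinimal] (p ℓ : ℕ) [Fact ℓ.Prime]
    (K : Type) [Field K] [NumberField K] : Prop :=
  IsImaginaryQuadratic K ∧ NumberField.discr K < -4 ∧ TwistedWanPrime W p ℓ ∧ NonsplitClassAt W ℓ K ∧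
    (∀ r : ℕ, r.Prime → r ∣ W.conductorNorm ℤ → r ≠ ℓ → ((Ideal.span {(r : ℤ)}).primesOver (𝓞 K)).ncard = 2) ∧
    (¬ 2 ∣ W.conductorNorm ℤ → ((Ideal.span {(2 : ℤ)}).primesOver (𝓞 K)).ncard = 2) ∧
    SatisfiesHeegnerHypothesis p K

/-- THE E3′ SUB-ROW OF THE RANK-ONE LINE (crux 19358; sketch v4 verbatim): `p ≥ 5`, `ρ̄` onto, every additive prime `≠ p` of quadratic-twist
type, an E3′ Wan prime. [predicate; nothing asserted] -/
def TwistedWanRoadRow (W : WeierstrassCurve ℚ) [W.IsElliptic] [W.IsGloballyMinimal] (p : ℕ) [Fact p.Prime] : Prop :=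
  5 ≤ p ∧ Surj W p ∧
    (∀ r : Nat.Primes, (r : ℕ) = 2 → W.HasAdditiveReductionAt ((primesEquiv (R := ℤ)).symm r) →
      ∃ t : ℤ, (t = -1 ∨ t = 2 ∨ t = -2) ∧
        ¬ (W.quadraticTwist (t : ℚ)).HasAdditiveReductionAt ((primesEquiv (R := ℤ)).symm r)) ∧
    (∀ r : Nat.Primes, (r : ℕ) ≠ 2 → W.HasAdditiveReductionAt ((primesEquiv (R := ℤ)).symm r) →
      ¬ (W.quadraticTwist (((-1 : ℤ) ^ ((r : ℕ) / 2) * r : ℤ) : ℚ)).HasAdditiveReductionAt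
        ((primesEquiv (R := ℤ)).symm r)) ∧
    (∃ ℓ : ℕ, ∃ _ : Fact ℓ.Prime, TwistedWanPrime W p ℓ)

/-- CASE A OF THE FIRST E3′ CUT, rank-one line (sketch v4 verbatim): an ODD twisted Wan prime `ℓ₀` with `p ∤ ℓ₀ + 1` and `W₁` NON-SPLIT at
`ℓ₀`. [predicate; nothing asserted] -/
def TwistedWanRoadRowFirstCutA (W : WeierstrassCurve ℚ) [W.IsElliptic] [W.IsGloballyMinimal] (p : ℕ) [Fact p.Prime] : Prop :=
  TwistedWanRoadRow W p ∧ ∃ ℓ : ℕ, ∃ _ : Fact ℓ.Prime, TwistedWanPrime W p ℓ ∧ ℓ ≠ 2 ∧ ¬ p ∣ ℓ + 1 ∧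
    ¬ (W.quadraticTwist ((primeStar ℓ : ℤ) : ℚ)).HasSplitMultiplicativeReductionAtPrime ℓ

/-- THE E3′ SUB-ROW OF THE RANK-ZERO LINE (crux 19357 `three_field_road` v37 verbatim): the rank-one sub-row's clauses and the r0 Tamagawa
clause `p ∤ ∏ c_ℓ`. [predicate; nothing asserted] -/
def TwistedWanRowR0 (W : WeierstrassCurve ℚ) [W.IsElliptic] [W.IsGloballyMinimal] (p : ℕ) [Fact p.Prime] : Prop :=
  5 ≤ p ∧ Surj W p ∧
    (∀ r : Nat.Primes, (r : ℕ) = 2 → W.HasAdditiveReductionAt ((primesEquiv (R := ℤ)).symm r) →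
      ∃ t : ℤ, (t = -1 ∨ t = 2 ∨ t = -2) ∧
        ¬ (W.quadraticTwist (t : ℚ)).HasAdditiveReductionAt ((primesEquiv (R := ℤ)).symm r)) ∧
    (∀ r : Nat.Primes, (r : ℕ) ≠ 2 → W.HasAdditiveReductionAt ((primesEquiv (R := ℤ)).symm r) →
      ¬ (W.quadraticTwist (((-1 : ℤ) ^ ((r : ℕ) / 2) * r : ℤ) : ℚ)).HasAdditiveReductionAt
        ((primesEquiv (R := ℤ)).symm r)) ∧
    (∃ ℓ : ℕ, ∃ _ : Fact ℓ.Prime, TwistedWanPrime W p ℓ) ∧ ¬ p ∣ W.tamagawaProduct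

/-- CASE A OF THE FIRST E3′ CUT, rank-zero line (19357 v37 verbatim). [predicate; nothing asserted] -/
def TwistedWanRowR0FirstCutA (W : WeierstrassCurve ℚ) [W.IsElliptic] [W.IsGloballyMinimal] (p : ℕ) [Fact p.Prime] : Prop :=
  TwistedWanRowR0 W p ∧ ∃ ℓ : ℕ, ∃ _ : Fact ℓ.Prime, TwistedWanPrime W p ℓ ∧ ℓ ≠ 2 ∧ ¬ p ∣ ℓ + 1 ∧
    ¬ (W.quadraticTwist ((primeStar ℓ : ℤ) : ℚ)).HasSplitMultiplicativeReductionAtPrime ℓ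

/-- The rank-zero sub-row is the rank-one sub-row with the Tamagawa clause (projection). [folklore] -/
theorem twistedWanRoadRow_of_twistedWanRowR0 (W : WeierstrassCurve ℚ) [W.IsElliptic] [W.IsGloballyMinimal] (p : ℕ) [Fact p.Prime]
    (h : TwistedWanRowR0 W p) : TwistedWanRoadRow W p ∧ ¬ p ∣ W.tamagawaProduct :=
  ⟨⟨h.1, h.2.1, h.2.2.1, h.2.2.2.1, h.2.2.2.2.1⟩, h.2.2.2.2.2⟩

/-- The rank-zero first cut is the rank-one first cut with the Tamagawa clause (projection). [folklore] -/
theorem twistedWanRoadRowFirstCutA_of_twistedWanRowR0FirstCutA (W : WeierstrassCurve ℚ) [W.IsElliptic] [W.IsGloballyMinimal] (p : ℕ)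
    [Fact p.Prime] (h : TwistedWanRowR0FirstCutA W p) : TwistedWanRoadRowFirstCutA W p ∧ ¬ p ∣ W.tamagawaProduct :=
  ⟨⟨(twistedWanRoadRow_of_twistedWanRowR0 W p h.1).1, h.2⟩, (twistedWanRoadRow_of_twistedWanRowR0 W p h.1).2⟩

/-- THE E3′ RANK-ONE FIELD SUPPLY (sketch v4 verbatim; proof needs Friedberg–Hoffstein 1995 Thm B in the GENERAL form, reading R5 — NOT in the
tree). This is LINE VOCABULARY (a statement to be proved, the registered stub `stub_fieldOneTwisted` of 19358 v26), not a Literature fact;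
the print behind it is Friedberg–Hoffstein 1995 Theorem B. [statement only; nothing asserted] -/
def FieldOneTwisted : Prop :=
  ∀ (W : WeierstrassCurve ℚ) [W.IsElliptic] [W.IsGloballyMinimal], exists_isNewformOf →
    (∀ r : Nat.Primes, (r : ℕ) = 2 → W.HasAdditiveReductionAt ((primesEquiv (R := ℤ)).symm r) →
      ∃ t : ℤ, (t = -1 ∨ t = 2 ∨ t = -2) ∧
        ¬ (W.quadraticTwist (t : ℚ)).HasAdditiveReductionAt ((primesEquiv (R := ℤ)).symm r)) →
    (∀ r : Nat.Primes, (r : ℕ) ≠ 2 → W.HasAdditiveReductionAt ((primesEquiv (R := ℤ)).symm r) →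
      ¬ (W.quadraticTwist (((-1 : ℤ) ^ ((r : ℕ) / 2) * r : ℤ) : ℚ)).HasAdditiveReductionAt
        ((primesEquiv (R := ℤ)).symm r)) →
    W.rootNumber = -1 →
    ∀ (p ℓ : ℕ) [Fact ℓ.Prime], p.Prime → p ≠ 2 → TwistedWanPrime W p ℓ → ∀ B : ℕ,
      ∃ (K : Type) (_ : Field K) (_ : NumberField K),
        TameRoadFieldTwisted W p ℓ K ∧ B < (NumberField.discr K).natAbs ∧
          (W.quadraticTwist (NumberField.discr K : ℚ)).entireLFunction 1 ≠ 0

/-- THE E3′ RANK-ZERO FIELD SUPPLY (sketch v4 / 19357 v37 verbatim; proof needs Friedberg–Hoffstein 1995 Thm B, second alternative, in the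
GENERAL form, reading R5 — NOT in the tree). This is LINE VOCABULARY (the registered stub `stub_fieldOneTwistedR0` of 19357 v37), not a
Literature fact; the print behind it is Friedberg–Hoffstein 1995 Theorem B. [statement only; nothing asserted] -/
def FieldOneTwistedR0 : Prop :=
  ∀ (W : WeierstrassCurve ℚ) [W.IsElliptic] [W.IsGloballyMinimal], exists_isNewformOf →
    (∀ r : Nat.Primes, (r : ℕ) = 2 → W.HasAdditiveReductionAt ((primesEquiv (R := ℤ)).symm r) →
      ∃ t : ℤ, (t = -1 ∨ t = 2 ∨ t = -2) ∧
        ¬ (W.quadraticTwist (t : ℚ)).HasAdditiveReductionAt ((primesEquiv (R := ℤ)).symm r)) →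
    (∀ r : Nat.Primes, (r : ℕ) ≠ 2 → W.HasAdditiveReductionAt ((primesEquiv (R := ℤ)).symm r) →
      ¬ (W.quadraticTwist (((-1 : ℤ) ^ ((r : ℕ) / 2) * r : ℤ) : ℚ)).HasAdditiveReductionAt
        ((primesEquiv (R := ℤ)).symm r)) →
    W.rootNumber = 1 →
    ∀ (p ℓ : ℕ) [Fact ℓ.Prime], p.Prime → p ≠ 2 → TwistedWanPrime W p ℓ → ∀ B : ℕ,
      ∃ (K : Type) (_ : Field K) (_ : NumberField K),
        TameRoadFieldTwisted W p ℓ K ∧ B < (NumberField.discr K).natAbs ∧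
          (W.quadraticTwist (NumberField.discr K : ℚ)).entireLFunction 1 = 0 ∧
          deriv (W.quadraticTwist (NumberField.discr K : ℚ)).entireLFunction 1 ≠ 0

/-- THE E3′ ROOT-NUMBER ENGINE ON THE FIRST CUT (statement): for modular `E` whose odd additive primes are of quadratic-twist type and which
is NOT additive at `2`, and a twisted road field `K` at a twisted Wan prime `ℓ` at which `W₁ = E^{(ℓ*)}` is NON-SPLIT (case A),
`w(E^{(d_K)}) = −w(E)`. The sketch's `EngineTwisted` restricted to the first cut; PROVED below. [statement; proved: `engineTwistedFirstCut_holds`] -/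
def EngineTwistedFirstCut : Prop :=
  ∀ (W : WeierstrassCurve ℚ) [W.IsElliptic] [W.IsGloballyMinimal], exists_isNewformOf →
    (∀ r : Nat.Primes, (r : ℕ) ≠ 2 → W.HasAdditiveReductionAt ((primesEquiv (R := ℤ)).symm r) →
      ¬ (W.quadraticTwist (((-1 : ℤ) ^ ((r : ℕ) / 2) * r : ℤ) : ℚ)).HasAdditiveReductionAt
        ((primesEquiv (R := ℤ)).symm r)) →
    ¬ W.HasAdditiveReductionAt ((primesEquiv (R := ℤ)).symm ⟨2, Nat.prime_two⟩) →
    ∀ (p ℓ : ℕ) [Fact ℓ.Prime] (K : Type) [Field K] [NumberField K], TameRoadFieldTwisted W p ℓ K →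
      ¬ (W.quadraticTwist ((primeStar ℓ : ℤ) : ℚ)).HasSplitMultiplicativeReductionAtPrime ℓ →
      (W.quadraticTwist (NumberField.discr K : ℚ)).rootNumber = -W.rootNumber

/-- In case A the class clause is the residue class `(d_K/ℓ* / ℓ) = +1`. [folklore] -/
theorem legendreSym_eq_one_of_nonsplitClassAt_of_not_split (W : WeierstrassCurve ℚ) [W.IsElliptic] (ℓ : ℕ) [Fact ℓ.Prime]
    (K : Type) [Field K] [NumberField K] (h : NonsplitClassAt W ℓ K)
    (hns : ¬ (W.quadraticTwist ((primeStar ℓ : ℤ) : ℚ)).HasSplitMultiplicativeReductionAtPrime ℓ) :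
    legendreSym ℓ (NumberField.discr K / primeStar ℓ) = 1 := by
  rw [h.2, if_neg hns]

/-- **THE FIRST-CUT ENGINE IS A THEOREM OF THE TREE**: `TwistRootNumberTwisted.rootNumber_quadraticTwist_discr_eq_neg_of_twistedRoadField_caseA`
(p796997, LEAD g15) read through the named predicates. -/
theorem engineTwistedFirstCut_holds : EngineTwistedFirstCut := by
  intro W _ _ hmod htt h2 p ℓ hℓ K _ _ hK hns
  obtain ⟨hIQ, -, ⟨-, hℓ2, hadd, hmult, -⟩, hclass, hsplit, h2split, -⟩ := hK
  exact TwistRootNumberTwisted.rootNumber_quadraticTwist_discr_eq_neg_of_twistedRoadField_caseA W hmod htt h2 hℓ2 hadd hmult hns K hIQ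
    hclass.1 (legendreSym_eq_one_of_nonsplitClassAt_of_not_split W ℓ K hclass hns) hsplit h2split

/-! ### §2 (appended, LEAD g15, skeleton v38): THE FIRST CUT WITHOUT AN ADDITIVE `2`, and the engine on every odd row BY NAME

The registered first cut of 19357 v37 (`TwistedWanRowR0FirstCutA`) allowed an additive `2` of quadratic-twist type; the landed engine
(`TwistRootNumberTwisted.rootNumber_quadraticTwist_discr_eq_neg_of_twistedRoadField`, p797470: BOTH classes) asks «`E` not additive at `2`»
(at an additive `2` the Atkin–Lehner sign of the level-dropped newform needs an oldform law the tree lacks). v38 therefore cuts at «no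
additive `2`» (88 % of the case-A first-cut rows of the pen's e19 census keep it) and states the field supplies with the same clause, so that
`stub_fieldOneTwistedR0` = reading R5 ∘ `engineTwistedNoAddTwo_holds` ∘ bookkeeping, with no further engine. -/

/-- THE FIRST CUT OF THE RANK-ONE LINE WITHOUT AN ADDITIVE `2` (for the pen's 19358 mirror): case A and `E` not additive at `2`.
[predicate; nothing asserted] -/
def TwistedWanRoadRowCutOne (W : WeierstrassCurve ℚ) [W.IsElliptic] [W.IsGloballyMinimal] (p : ℕ) [Fact p.Prime] : Prop :=
  TwistedWanRoadRowFirstCutA W p ∧ ¬ W.HasAdditiveReductionAt ((primesEquiv (R := ℤ)).symm ⟨2, Nat.prime_two⟩)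

/-- THE FIRST CUT OF THE RANK-ZERO LINE WITHOUT AN ADDITIVE `2` (19357 `three_field_road` v38): case A and `E` not additive at `2`.
[predicate; nothing asserted] -/
def TwistedWanRowR0CutOne (W : WeierstrassCurve ℚ) [W.IsElliptic] [W.IsGloballyMinimal] (p : ℕ) [Fact p.Prime] : Prop :=
  TwistedWanRowR0FirstCutA W p ∧ ¬ W.HasAdditiveReductionAt ((primesEquiv (R := ℤ)).symm ⟨2, Nat.prime_two⟩)

/-- THE E3′ RANK-ONE FIELD SUPPLY ON THE CUT WITHOUT AN ADDITIVE `2` (`FieldOneTwisted` with the extra binder «`E` not additive at `2`»;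
its proof = Friedberg–Hoffstein Thm B general form (reading R5) ∘ `engineTwistedNoAddTwo_holds` ∘ Dirichlet/CRT bookkeeping). LINE VOCABULARY,
not a Literature fact. [statement only; nothing asserted] -/
def FieldOneTwistedCutOne : Prop :=
  ∀ (W : WeierstrassCurve ℚ) [W.IsElliptic] [W.IsGloballyMinimal], exists_isNewformOf →
    (∀ r : Nat.Primes, (r : ℕ) ≠ 2 → W.HasAdditiveReductionAt ((primesEquiv (R := ℤ)).symm r) →
      ¬ (W.quadraticTwist (((-1 : ℤ) ^ ((r : ℕ) / 2) * r : ℤ) : ℚ)).HasAdditiveReductionAt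
        ((primesEquiv (R := ℤ)).symm r)) →
    ¬ W.HasAdditiveReductionAt ((primesEquiv (R := ℤ)).symm ⟨2, Nat.prime_two⟩) →
    W.rootNumber = -1 →
    ∀ (p ℓ : ℕ) [Fact ℓ.Prime], p.Prime → p ≠ 2 → TwistedWanPrime W p ℓ → ∀ B : ℕ,
      ∃ (K : Type) (_ : Field K) (_ : NumberField K),
        TameRoadFieldTwisted W p ℓ K ∧ B < (NumberField.discr K).natAbs ∧
          (W.quadraticTwist (NumberField.discr K : ℚ)).entireLFunction 1 ≠ 0

/-- THE E3′ RANK-ZERO FIELD SUPPLY ON THE CUT WITHOUT AN ADDITIVE `2` (`FieldOneTwistedR0` with the extra binder «`E` not additive at `2`»;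
the statement of 19357 v38's `stub_fieldOneTwistedR0`). LINE VOCABULARY, not a Literature fact. [statement only; nothing asserted] -/
def FieldOneTwistedR0CutOne : Prop :=
  ∀ (W : WeierstrassCurve ℚ) [W.IsElliptic] [W.IsGloballyMinimal], exists_isNewformOf →
    (∀ r : Nat.Primes, (r : ℕ) ≠ 2 → W.HasAdditiveReductionAt ((primesEquiv (R := ℤ)).symm r) →
      ¬ (W.quadraticTwist (((-1 : ℤ) ^ ((r : ℕ) / 2) * r : ℤ) : ℚ)).HasAdditiveReductionAt
        ((primesEquiv (R := ℤ)).symm r)) →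
    ¬ W.HasAdditiveReductionAt ((primesEquiv (R := ℤ)).symm ⟨2, Nat.prime_two⟩) →
    W.rootNumber = 1 →
    ∀ (p ℓ : ℕ) [Fact ℓ.Prime], p.Prime → p ≠ 2 → TwistedWanPrime W p ℓ → ∀ B : ℕ,
      ∃ (K : Type) (_ : Field K) (_ : NumberField K),
        TameRoadFieldTwisted W p ℓ K ∧ B < (NumberField.discr K).natAbs ∧
          (W.quadraticTwist (NumberField.discr K : ℚ)).entireLFunction 1 = 0 ∧
          deriv (W.quadraticTwist (NumberField.discr K : ℚ)).entireLFunction 1 ≠ 0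

/-- THE E3′ ROOT-NUMBER ENGINE ON EVERY ODD ROW (statement; the sketch's `EngineTwisted` with the one extra binder «`E` not additive at
`2`», BOTH classes of `NonsplitClassAt`). [statement; proved: `engineTwistedNoAddTwo_holds`] -/
def EngineTwistedNoAddTwo : Prop :=
  ∀ (W : WeierstrassCurve ℚ) [W.IsElliptic] [W.IsGloballyMinimal], exists_isNewformOf →
    (∀ r : Nat.Primes, (r : ℕ) ≠ 2 → W.HasAdditiveReductionAt ((primesEquiv (R := ℤ)).symm r) →
      ¬ (W.quadraticTwist (((-1 : ℤ) ^ ((r : ℕ) / 2) * r : ℤ) : ℚ)).HasAdditiveReductionAt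
        ((primesEquiv (R := ℤ)).symm r)) →
    ¬ W.HasAdditiveReductionAt ((primesEquiv (R := ℤ)).symm ⟨2, Nat.prime_two⟩) →
    ∀ (p ℓ : ℕ) [Fact ℓ.Prime] (K : Type) [Field K] [NumberField K], TameRoadFieldTwisted W p ℓ K →
      (W.quadraticTwist (NumberField.discr K : ℚ)).rootNumber = -W.rootNumber

/-- **THE ENGINE ON EVERY ODD ROW IS A THEOREM OF THE TREE**: `TwistRootNumberTwisted.rootNumber_quadraticTwist_discr_eq_neg_of_twistedRoadField`
(p797470, LEAD g15; both classes, via the unit-twist split law) read through the named predicates. -/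
theorem engineTwistedNoAddTwo_holds : EngineTwistedNoAddTwo := by
  intro W _ _ hmod htt h2 p ℓ hℓ K _ _ hK
  obtain ⟨hIQ, -, ⟨-, hℓ2, hadd, hmult, -⟩, hclass, hsplit, h2split, -⟩ := hK
  exact TwistRootNumberTwisted.rootNumber_quadraticTwist_discr_eq_neg_of_twistedRoadField W hmod htt h2 hℓ2 hadd hmult K hIQ
    hclass.1 hclass.2 hsplit h2split

/-- The first-cut engine as a COROLLARY of the odd-row engine (sanity: case A is a special case). -/
theorem engineTwistedFirstCut_of_noAddTwo (h : EngineTwistedNoAddTwo) : EngineTwistedFirstCut :=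
  fun W _ _ hmod htt h2 p ℓ _ K _ _ hK _ ↦ h W hmod htt h2 p ℓ K hK

/-! ## §3 (append, LEAD cruxlead-19357 g16 landing pen bsd-addord-plan g46 draft (ii) `TwistedJointLowerSumDraft.lean` e9e096b847543dff VERBATIM;
appended here rather than filed as `…TwistedJointLowerSum.lean` because parameterless statement `def`s live in the route's `…Defs.lean` file)

# THE JOINT LOWER HALF OVER A TWISTED ROAD FIELD — RANK-SYMMETRIC FORM (brick E3′, FIELD 1 of both kernels; pen bsd-addord-plan g46, E368)

Definitions + two one-line specialisations (a DRAFT, r2 = r1 + the cut binder `¬ p ∣ q + 1` in all three shapes; landable VERBATIM as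
`Theorems/AdditiveBranchIMCGordTwoTwistedJointLowerSum.lean` — `--kind definition`, `--supports stmt-BirchSwinnertonDyer-19358 --as helper`).
ONE statement, `TwistedWanRoad.JointLowerTwistedSum`, whose proof closes BOTH registered [L] stubs of the (G-ord, `e = 2`) twisted Wan road:
19357 `three_field_road` v40 `stub_jointLowerTwistedR0 : PrintedFactsR0 → JointLowerTwistedR0` (LEAD g15) and 19358 `wan_tame_bdp_road` v30
`stub_jointLowerTwisted : PrintedFactsTame → JointLowerTwisted` (pen mirror), via `jointLowerTwisted_rankZero_of_sum` / `jointLowerTwisted_rankOne_of_sum`.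
Nothing is asserted: `JointLowerTwistedSum` is LINE VOCABULARY (a statement to be proved from readings R2–R4), not a Literature fact.
BSD is proved for no curve by this file.
References: [CastellaLiuWan2022] Thm. 8.2.1 (1), §6.1; [Hsieh2014] Thm. B; [LiuZhangZhang2018] Thm. 1.5.1/1.5.3; [CaiShuTian2014] Thm. 1.1.
-/

open Literature.NumberTheory.EllipticCurves.Rank1Residual Literature.NumberTheory.EllipticCurves.Rank1Residual.Typed


/-- **THE JOINT LOWER HALF OVER A TWISTED ROAD FIELD, RANK-SYMMETRIC FORM.** For `E` on cell (G-ord, `e = 2`) on the rank-one cut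
`TwistedWanRoadRowCutOne` (`p ≥ 5`, `ρ̄` onto, additive primes of twist type, an odd potentially-multiplicative additive twist-type prime
`ℓ₀ ≠ p` with `p ∤ v_{ℓ₀}(j)`, `p ∤ ℓ₀ + 1`, `W₁ = E^{(ℓ₀*)}` non-split at `ℓ₀`, `E` not additive at `2` — the rank-zero cut
`TwistedWanRowR0CutOne` is this plus `p ∤ ∏ c`), a twisted road field `K` at `q`, a globally minimal `Wd ≅ E^{(d_K)}` with
`r_an(E) + r_an(Wd) = 1`, ON THE CUT `p ∤ q + 1` (r2: the binder under which the LEAD's twisted Waldspurger unit has `‖u‖ = 1` and Hsieh's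
Theorem B applies — the same binder as v41's `JointLowerTwistedR0`): `JointLowerBoundAt E Wd p`. This is FIELD 1 of BOTH kernels: the four steps of the E2 port
(`WanAnyRoad.flatInclusion_wanAny` ⟹ `branchSocketAt_of_flatInclusionUnit_rankFree_wanAny` ⟹ `tameStepLAt_of_branchSocketAt_wanAny` ⟹
`jointLowerBoundAt_of_tameRoadFieldAny_of_stepL`) are rank-symmetric (binder `W.analyticRank + Wd.analyticRank = 1`) and Tamagawa-free, so their
port to `TameRoadFieldTwisted` (readings R2 p790160, R3 p790378, R4 p791091; the `ν`-branch of `W₁ = E^{(q*)}`, LeadReport23 §7/§11) proves THIS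
statement, and the two registered stubs are its specialisations `jointLowerTwisted_rankZero_of_sum` / `jointLowerTwisted_rankOne_of_sum` below.
RECOMMENDED THEOREMS-SIDE TARGET for the promote-stub seat: `theorem jointLowerTwistedSum_holds : <the R2–R4 named facts> → JointLowerTwistedSum`.
[statement only; L; nothing asserted; LINE VOCABULARY, not a Literature fact — the print behind its proof is Castella–Liu–Wan 2022 Thm. 8.2.1 (1),
Hsieh 2014 Thm. B, Liu–Zhang–Zhang 2018 Thm 1.5.1/1.5.3, Cai–Shu–Tian 2014 Thm. 1.1 (cite tags removed at landing so the gate does not relocate a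
parameterless statement `def` as a named fact)] -/
def JointLowerTwistedSum : Prop :=
  ∀ (W : WeierstrassCurve ℚ) [W.IsElliptic] [W.IsGloballyMinimal] (p : ℕ) [Fact p.Prime] (q : ℕ) [Fact q.Prime]
    (K : Type) [Field K] [NumberField K] (Wd : WeierstrassCurve ℚ) [Wd.IsElliptic] [Wd.IsGloballyMinimal],
    N10.CellGordTwo W p → TwistedWanRoadRowCutOne W p → TameRoadFieldTwisted W p q K →
    ¬ p ∣ q + 1 → (∃ C : VariableChange ℚ, C • W.quadraticTwist (NumberField.discr K : ℚ) = Wd) → W.analyticRank + Wd.analyticRank = 1 →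
    JointLowerBoundAt W Wd p

/-- The rank-one specialisation: `JointLowerTwistedSum` ⟹ the hypothesis `hJLT` of `twistedWanChain_of_jointLower` (= 19358 v30's
`JointLowerTwisted`). [folklore] -/
theorem jointLowerTwisted_rankOne_of_sum (h : JointLowerTwistedSum) :
    ∀ (W : WeierstrassCurve ℚ) [W.IsElliptic] [W.IsGloballyMinimal] (p : ℕ) [Fact p.Prime] (q : ℕ) [Fact q.Prime]
      (K : Type) [Field K] [NumberField K] (Wd : WeierstrassCurve ℚ) [Wd.IsElliptic] [Wd.IsGloballyMinimal],
      W.analyticRank = 1 → N10.CellGordTwo W p → TwistedWanRoadRowCutOne W p → TameRoadFieldTwisted W p q K →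
      ¬ p ∣ q + 1 → (∃ C : VariableChange ℚ, C • W.quadraticTwist (NumberField.discr K : ℚ) = Wd) → Wd.analyticRank = 0 →
      JointLowerBoundAt W Wd p :=
  fun W _ _ p _ q _ K _ _ Wd _ _ hr hcell hrow hK hq1 htw hrd ↦ h W p q K Wd hcell hrow hK hq1 htw (by omega)

/-- The rank-zero specialisation: `JointLowerTwistedSum` ⟹ the hypothesis `hJLT` of the LEAD's `twistedWanChainR0_of_jointLower` (p802099)
(= 19357 v40's `JointLowerTwistedR0`; the r₀ cut projects onto the r₁ cut by dropping the Tamagawa clause). [folklore] -/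
theorem jointLowerTwisted_rankZero_of_sum (h : JointLowerTwistedSum) :
    ∀ (W : WeierstrassCurve ℚ) [W.IsElliptic] [W.IsGloballyMinimal] (p : ℕ) [Fact p.Prime] (q : ℕ) [Fact q.Prime]
      (K : Type) [Field K] [NumberField K] (Wd : WeierstrassCurve ℚ) [Wd.IsElliptic] [Wd.IsGloballyMinimal],
      W.analyticRank = 0 → N10.CellGordTwo W p → TwistedWanRowR0CutOne W p → TameRoadFieldTwisted W p q K →
      ¬ p ∣ q + 1 → (∃ C : VariableChange ℚ, C • W.quadraticTwist (NumberField.discr K : ℚ) = Wd) → Wd.analyticRank = 1 →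
      JointLowerBoundAt W Wd p :=
  fun W _ _ p _ q _ K _ _ Wd _ _ hr hcell hrow hK hq1 htw hrd ↦
    h W p q K Wd hcell ⟨(twistedWanRoadRowFirstCutA_of_twistedWanRowR0FirstCutA W p hrow.1).1, hrow.2⟩ hK hq1 htw (by omega)

end Summit.BirchSwinnertonDyer.BirchSwinnertonDyer.Theorems.TwistedWanRoad

end
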